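import Literature.Analysis.FluidPDE.TaoWeightedEulerForm
import HarnessLib

/-!
# Tao 2016, Def. 3.4 / §3.4: weighted Euler forms at the slots of a complex average —
measurability in `ω` and the summed absolute bound

T. Tao, *Finite time blowup for an averaged three-dimensional Navier–Stokes equation*,
J. Amer. Math. Soc. **29** (2016), 601–674 = arXiv:1402.0290v3 (held as `paper:arxiv-1402.0290`),
§3.1 Def. 3.4 (3.4)–(3.5) p. 15 and §3.4 p. 17 ("Summing, we see that
`⟨C(u,v), w⟩ = (1/(-πi)) ∫_Ω ⟨B_{η,ρ}(m̃₁(D)Rot u, m̃₂(D)Rot v), m̃₃(D)Rot w⟩ dμ` (as before, one can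
work first with Schwartz `u,v,w`, and then take limits)"). The exchange of `Σₙ` and `∫_Ω` in that
sentence needs, for a complex averaging datum `𝒟` and weights `Wₙ` with `Σₙ |Wₙ| ≤ 1`:

* `ComplexAveragingDatum.weightedForm_slot_eq_integral`,
  `ComplexAveragingDatum.stronglyMeasurable_weightedForm_slot` — the `Wₙ`-form at the slots,
  `ω ↦ W-form(A_{1,ω}u, A_{2,ω}v, A_{3,ω}w)`, is (strongly) measurable (as for the Euler form in
  `TaoAveragedSlotMeasurable.lean`: a parametric integral of a jointly measurable integrand);
* `ComplexAveragingDatum.lintegral_enorm_eulerIntegrand_slot_le` — the absolute `ℝ⁶`-integral of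
  the Euler integrand at the slots is at most
  `2C_emb (M‖u‖_{H¹⁰}) (M‖v‖_{H¹⁰}) ‖w‖ ‖m_{1,ω}‖₀ ‖m_{2,ω}‖₀ ‖m_{3,ω}‖₀` (Tao p. 7);
* `ComplexAveragingDatum.tsum_lintegral_enorm_weightedForm_slot_lt_top` — **hence
  `Σₙ ∫_Ω |Wₙ-form(A_{1,ω}u, A_{2,ω}v, A_{3,ω}w)| dμ < ∞`** for `u, v ∈ H¹⁰`, `w ∈ L²`, by (3.5) with
  `k₁ = k₂ = k₃ = 0` (Tonelli twice and `Σₙ |Wₙ| ≤ 1`).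

## References

* T. Tao, J. Amer. Math. Soc. 29 (2016), 601–674, arXiv:1402.0290v3, §1.1 p. 7, Def. 3.4 p. 15,
  §3.4 p. 17. Key `Tao2016AveragedNS`.
-/

noncomputable section

open MeasureTheory Set Filter FourierTransform
open scoped ENNReal NNReal

namespace Literature.Analysis.FluidPDE.Tao2016

/-- Local notation for physical / frequency space `ℝ³`. -/
local notation "ℝ³" => EuclideanSpace ℝ (Fin 3)
/-- Local notation for the complexified range `ℂ³`. -/
local notation "ℂ³" => EuclideanSpace ℂ (Fin 3)

namespace ComplexAveragingDatum

variable (𝒟 : ComplexAveragingDatum)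

/-- The jointly measurable version of `(ω, ξ) ↦ 𝓕(A_{i,ω} u)(ξ)` of
`TaoAveragedSlotMeasurable.lean`, named. [cite: Tao2016AveragedNS, Def. 3.4] -/
def fourierSlotFn (i : Fin 3) (u : L2C) (q : 𝒟.Ω × ℝ³) : ℂ³ :=
  Set.indicator {0}ᶜ (𝒟.m i q.1) q.2 •
    complexifyCLM (𝒟.R i q.1).toLinearIsometry.toContinuousLinearMap
      (((((𝒟.lam i q.1)⁻¹ ^ (3 / 2 : ℝ) : ℝ)) : ℂ) • fourierFn u ((𝒟.lam i q.1)⁻¹ • (𝒟.R i q.1).symm q.2))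

/-- `fourierSlotFn` is jointly measurable. [folklore] -/
theorem measurable_fourierSlotFn' (i : Fin 3) (u : L2C) : Measurable (𝒟.fourierSlotFn i u) :=
  𝒟.measurable_fourierSlotFn i u

/-- For every `ω`, `𝓕(A_{i,ω} u) = fourierSlotFn (ω, ·)` a.e. [cite: Tao2016AveragedNS, Def. 3.4] -/
theorem fourierFn_slot_ae_eq_fourierSlotFn (i : Fin 3) (θ : 𝒟.Ω) (u : L2C) :
    fourierFn (𝒟.slot i θ u) =ᵐ[volume] fun ξ => 𝒟.fourierSlotFn i u (θ, ξ) :=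
  𝒟.fourierFn_slot_ae_eq i θ u

/-- The **jointly measurable Euler integrand at the slots**:
`(ω, ξ₁, ξ₂) ↦ Λ(F₁(ω,ξ₁), F₂(ω,ξ₂), F₃(ω,-ξ₁-ξ₂))`. [cite: Tao2016AveragedNS, Def. 3.4 (3.4)] -/
def slotIntegrand (u v w : L2C) (q : 𝒟.Ω × (ℝ³ × ℝ³)) : ℂ :=
  Λ q.2.1 q.2.2 (𝒟.fourierSlotFn 0 u (q.1, q.2.1)) (𝒟.fourierSlotFn 1 v (q.1, q.2.2))
    (𝒟.fourierSlotFn 2 w (q.1, -q.2.1 - q.2.2))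

/-- The slot integrand is jointly measurable on `Ω × ℝ⁶`. [folklore] -/
theorem measurable_slotIntegrand (u v w : L2C) : Measurable (𝒟.slotIntegrand u v w) := by
  have hFm := fun j x => 𝒟.measurable_fourierSlotFn' j x
  have heq : 𝒟.slotIntegrand u v w = (fun r : (ℝ³ × ℝ³) × (ℂ³ × ℂ³ × ℂ³) =>
        Λ r.1.1 r.1.2 r.2.1 r.2.2.1 r.2.2.2) ∘
      fun q : 𝒟.Ω × (ℝ³ × ℝ³) =>
        (q.2, (𝒟.fourierSlotFn 0 u (q.1, q.2.1), 𝒟.fourierSlotFn 1 v (q.1, q.2.2),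
          𝒟.fourierSlotFn 2 w (q.1, -q.2.1 - q.2.2))) := rfl
  rw [heq]
  refine continuous_Λ.measurable.comp (measurable_snd.prodMk ((((hFm 0 u).comp
    (measurable_fst.prodMk (measurable_fst.comp measurable_snd))).prodMk
    (((hFm 1 v).comp (measurable_fst.prodMk (measurable_snd.comp measurable_snd))).prodMk
    ((hFm 2 w).comp (measurable_fst.prodMk ?_))))))
  exact (measurable_fst.comp measurable_snd).neg.sub (measurable_snd.comp measurable_snd)

/-- For every `ω`, the Euler integrand of the slots is a.e. the slot integrand. [cite: Tao2016AveragedNS, Def. 3.4 (3.4)] -/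
theorem eulerIntegrand_slot_ae_eq (u v w : L2C) (θ : 𝒟.Ω) :
    eulerIntegrand (𝒟.slot 0 θ u) (𝒟.slot 1 θ v) (𝒟.slot 2 θ w) =ᵐ[volume]
      fun p => 𝒟.slotIntegrand u v w (θ, p) := by
  unfold eulerIntegrand slotIntegrand
  filter_upwards [ae_prod_of_ae₁ (𝒟.fourierFn_slot_ae_eq_fourierSlotFn 0 θ u),
    ae_prod_of_ae₂ (𝒟.fourierFn_slot_ae_eq_fourierSlotFn 1 θ v),
    ae_prod_of_ae₃ (𝒟.fourierFn_slot_ae_eq_fourierSlotFn 2 θ w)] with p h1 h2 h3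
  rw [h1, h2, h3]

/-- **The weighted form at the slots as a parametric integral of a jointly measurable function.** [cite: Tao2016AveragedNS, Def. 3.4 (3.4)] -/
theorem weightedForm_slot_eq_integral (W : ℝ³ × ℝ³ → ℝ) (u v w : L2C) (θ : 𝒟.Ω) :
    weightedForm W (𝒟.slot 0 θ u) (𝒟.slot 1 θ v) (𝒟.slot 2 θ w) =
      ∫ p, ((W p : ℝ) : ℂ) * 𝒟.slotIntegrand u v w (θ, p) := by
  unfold weightedForm
  refine integral_congr_ae ?_
  filter_upwards [𝒟.eulerIntegrand_slot_ae_eq u v w θ] with p hp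
  rw [hp]

/-- **The weighted form at the slots is (strongly) measurable in `ω`** for a measurable weight. [cite: Tao2016AveragedNS, Def. 3.4 (3.4)] -/
theorem stronglyMeasurable_weightedForm_slot {W : ℝ³ × ℝ³ → ℝ} (hW : Measurable W) (u v w : L2C) :
    StronglyMeasurable fun θ => weightedForm W (𝒟.slot 0 θ u) (𝒟.slot 1 θ v) (𝒟.slot 2 θ w) := by
  have hmeas : Measurable fun q : 𝒟.Ω × (ℝ³ × ℝ³) => ((W q.2 : ℝ) : ℂ) * 𝒟.slotIntegrand u v w q :=
    (Complex.continuous_ofReal.measurable.comp (hW.comp measurable_snd)).mul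
      (𝒟.measurable_slotIntegrand u v w)
  have h : StronglyMeasurable fun θ => ∫ p, ((W p : ℝ) : ℂ) * 𝒟.slotIntegrand u v w (θ, p) :=
    hmeas.stronglyMeasurable.integral_prod_right'
  have heq : (fun θ => weightedForm W (𝒟.slot 0 θ u) (𝒟.slot 1 θ v) (𝒟.slot 2 θ w)) =
      fun θ => ∫ p, ((W p : ℝ) : ℂ) * 𝒟.slotIntegrand u v w (θ, p) :=
    funext fun θ => 𝒟.weightedForm_slot_eq_integral W u v w θ
  rw [heq]
  exact h

/-- A.e.-strong measurability, for the Bochner integral over `Ω`. [cite: Tao2016AveragedNS, Def. 3.4 (3.4)] -/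
theorem aestronglyMeasurable_weightedForm_slot {W : ℝ³ × ℝ³ → ℝ} (hW : Measurable W) (u v w : L2C) :
    AEStronglyMeasurable (fun θ => weightedForm W (𝒟.slot 0 θ u) (𝒟.slot 1 θ v) (𝒟.slot 2 θ w)) 𝒟.μ :=
  (𝒟.stronglyMeasurable_weightedForm_slot hW u v w).aestronglyMeasurable

/-! ### The absolute bound, summed over weights -/

/-- The absolute `ℝ⁶`-lintegral of the slot integrand is measurable in `ω`. [folklore] -/
theorem measurable_lintegral_weight_slotIntegrand {W : ℝ³ × ℝ³ → ℝ≥0∞} (hW : Measurable W)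
    (u v w : L2C) :
    Measurable fun θ => ∫⁻ p, W p * ‖𝒟.slotIntegrand u v w (θ, p)‖ₑ := by
  have hmeas : Measurable fun q : 𝒟.Ω × (ℝ³ × ℝ³) => W q.2 * ‖𝒟.slotIntegrand u v w q‖ₑ :=
    (hW.comp measurable_snd).mul (𝒟.measurable_slotIntegrand u v w).enorm
  exact hmeas.lintegral_prod_right'

/-- **The absolute convergence of the Euler integrand at the slots** (Tao p. 7, "duality, the
triangle inequality … and the multiplier bounds"): if `λ_{i,ω} ≤ C` then
`∫∫ |Λ(𝓕(A₁u), 𝓕(A₂v), 𝓕(A₃w))| ≤ 2C_emb (M‖u‖_{H¹⁰}) (M‖v‖_{H¹⁰}) ‖w‖ · ‖m₁‖₀‖m₂‖₀‖m₃‖₀`,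
`M = max(1,C)^{10}`. [cite: Tao2016AveragedNS, §1.1 p. 7 and Def. 3.4] -/
theorem lintegral_enorm_eulerIntegrand_slot_le {C : ℝ} (hC : ∀ i θ, 𝒟.lam i θ ≤ C) (u v w : L2C)
    (θ : 𝒟.Ω) :
    ∫⁻ p, ‖eulerIntegrand (𝒟.slot 0 θ u) (𝒟.slot 1 θ v) (𝒟.slot 2 θ w) p‖ₑ ≤
      2 * (∫⁻ ξ : ℝ³, ENNReal.ofReal ((1 + ‖ξ‖ ^ 2) ^ (-10 : ℝ))) ^ (1 / 2 : ℝ) *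
        (ENNReal.ofReal (max 1 C ^ (10 : ℝ)) * FunctionSpaces.eFourierSobolevNorm 10 u) *
        (ENNReal.ofReal (max 1 C ^ (10 : ℝ)) * FunctionSpaces.eFourierSobolevNorm 10 v) * ‖w‖ₑ *
        (symbolSeminorm 0 (𝒟.m 0 θ) * symbolSeminorm 0 (𝒟.m 1 θ) * symbolSeminorm 0 (𝒟.m 2 θ)) := by
  have hK : ∀ i, ENNReal.ofReal (max 1 (𝒟.lam i θ) ^ (10 : ℝ)) ≤ ENNReal.ofReal (max 1 C ^ (10 : ℝ)) :=
    fun i => ENNReal.ofReal_le_ofReal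
      (Real.rpow_le_rpow (by positivity) (max_le_max le_rfl (hC i θ)) (by norm_num))
  have h0 : FunctionSpaces.eFourierSobolevNorm 10 (𝒟.slot 0 θ u) ≤ symbolSeminorm 0 (𝒟.m 0 θ) *
      (ENNReal.ofReal (max 1 C ^ (10 : ℝ)) * FunctionSpaces.eFourierSobolevNorm 10 u) := by
    refine (𝒟.eFourierSobolevNorm_slot_le 0 θ (by norm_num : (0 : ℝ) ≤ 10) u).trans ?_
    rw [mul_assoc]
    exact mul_le_mul' le_rfl (mul_le_mul' (hK 0) le_rfl)
  have h1 : FunctionSpaces.eFourierSobolevNorm 10 (𝒟.slot 1 θ v) ≤ symbolSeminorm 0 (𝒟.m 1 θ) *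
      (ENNReal.ofReal (max 1 C ^ (10 : ℝ)) * FunctionSpaces.eFourierSobolevNorm 10 v) := by
    refine (𝒟.eFourierSobolevNorm_slot_le 1 θ (by norm_num : (0 : ℝ) ≤ 10) v).trans ?_
    rw [mul_assoc]
    exact mul_le_mul' le_rfl (mul_le_mul' (hK 1) le_rfl)
  have h2 := 𝒟.enorm_slot_le 2 θ w
  calc ∫⁻ p, ‖eulerIntegrand (𝒟.slot 0 θ u) (𝒟.slot 1 θ v) (𝒟.slot 2 θ w) p‖ₑ
      ≤ 2 * (∫⁻ ξ : ℝ³, ENNReal.ofReal ((1 + ‖ξ‖ ^ 2) ^ (-10 : ℝ))) ^ (1 / 2 : ℝ) *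
          FunctionSpaces.eFourierSobolevNorm 10 (𝒟.slot 0 θ u) *
          FunctionSpaces.eFourierSobolevNorm 10 (𝒟.slot 1 θ v) * ‖𝒟.slot 2 θ w‖ₑ :=
        lintegral_enorm_Λ_fourierFn_le _ _ _
    _ ≤ 2 * (∫⁻ ξ : ℝ³, ENNReal.ofReal ((1 + ‖ξ‖ ^ 2) ^ (-10 : ℝ))) ^ (1 / 2 : ℝ) *
          (symbolSeminorm 0 (𝒟.m 0 θ) *
            (ENNReal.ofReal (max 1 C ^ (10 : ℝ)) * FunctionSpaces.eFourierSobolevNorm 10 u)) *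
          (symbolSeminorm 0 (𝒟.m 1 θ) *
            (ENNReal.ofReal (max 1 C ^ (10 : ℝ)) * FunctionSpaces.eFourierSobolevNorm 10 v)) *
          (symbolSeminorm 0 (𝒟.m 2 θ) * ‖w‖ₑ) := by
        gcongr
    _ = _ := by ring

/-- **`Σₙ ∫_Ω |Wₙ-form(A_{1,ω}u, A_{2,ω}v, A_{3,ω}w)| dμ < ∞`** for measurable weights with
`Σₙ |Wₙ| ≤ 1`, `u, v ∈ H¹⁰` and `w ∈ L²` (Tonelli on `ℤ × Ω × ℝ⁶`, the absolute bound above and the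
integrability condition (3.5) with `k₁ = k₂ = k₃ = 0`): the justification of "summing" in §3.4. [cite: Tao2016AveragedNS, §3.4 p. 17 and Def. 3.4 (3.5)] -/
theorem tsum_lintegral_enorm_weightedForm_slot_lt_top {Wn : ℤ → ℝ³ × ℝ³ → ℝ}
    (hmeas : ∀ n, Measurable (Wn n)) (hbound : ∀ p, ∑' n, ‖Wn n p‖ₑ ≤ 1) {u v : L2C} (w : L2C)
    (hu : FunctionSpaces.eFourierSobolevNorm 10 u < ∞) (hv : FunctionSpaces.eFourierSobolevNorm 10 v < ∞) :
    ∑' n, ∫⁻ θ, ‖weightedForm (Wn n) (𝒟.slot 0 θ u) (𝒟.slot 1 θ v) (𝒟.slot 2 θ w)‖ₑ ∂𝒟.μ < ∞ := by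
  obtain ⟨C, hC⟩ := 𝒟.lam_bdd
  -- the measurable majorants `Gₙ(θ) = ∫ |Wₙ| |slot integrand|`
  set G : ℤ → 𝒟.Ω → ℝ≥0∞ := fun n θ => ∫⁻ p, ‖Wn n p‖ₑ * ‖𝒟.slotIntegrand u v w (θ, p)‖ₑ with hG
  have hGm : ∀ n, Measurable (G n) := fun n =>
    𝒟.measurable_lintegral_weight_slotIntegrand (hmeas n).enorm u v w
  have hle : ∀ n θ, ‖weightedForm (Wn n) (𝒟.slot 0 θ u) (𝒟.slot 1 θ v) (𝒟.slot 2 θ w)‖ₑ ≤ G n θ := by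
    intro n θ
    refine (enorm_weightedForm_le _ _ _ _).trans (le_of_eq ?_)
    refine lintegral_congr_ae ?_
    filter_upwards [𝒟.eulerIntegrand_slot_ae_eq u v w θ] with p hp
    rw [hp]
  -- the constant of the absolute bound
  set K : ℝ≥0∞ := 2 * (∫⁻ ξ : ℝ³, ENNReal.ofReal ((1 + ‖ξ‖ ^ 2) ^ (-10 : ℝ))) ^ (1 / 2 : ℝ) *
    (ENNReal.ofReal (max 1 C ^ (10 : ℝ)) * FunctionSpaces.eFourierSobolevNorm 10 u) *
    (ENNReal.ofReal (max 1 C ^ (10 : ℝ)) * FunctionSpaces.eFourierSobolevNorm 10 v) * ‖w‖ₑ with hK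
  have hKtop : K < ∞ := by
    refine ENNReal.mul_lt_top (ENNReal.mul_lt_top (ENNReal.mul_lt_top (ENNReal.mul_lt_top
      ENNReal.ofNat_lt_top ?_) (ENNReal.mul_lt_top ENNReal.ofReal_lt_top hu))
      (ENNReal.mul_lt_top ENNReal.ofReal_lt_top hv)) enorm_lt_top
    exact ENNReal.rpow_lt_top_of_nonneg (by norm_num) lintegral_inv_sobolevWeight_lt_top.ne
  -- `Σₙ Gₙ(θ) ≤ ∫ |slot integrand| ≤ K ‖m₁‖₀‖m₂‖₀‖m₃‖₀`
  have hsum : ∀ θ, ∑' n, G n θ ≤ K * (symbolSeminorm 0 (𝒟.m 0 θ) * symbolSeminorm 0 (𝒟.m 1 θ) *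
      symbolSeminorm 0 (𝒟.m 2 θ)) := by
    intro θ
    have hSm : Measurable fun p : ℝ³ × ℝ³ => ‖𝒟.slotIntegrand u v w (θ, p)‖ₑ :=
      ((𝒟.measurable_slotIntegrand u v w).comp (measurable_const.prodMk measurable_id)).enorm
    calc ∑' n, G n θ = ∫⁻ p, ∑' n, ‖Wn n p‖ₑ * ‖𝒟.slotIntegrand u v w (θ, p)‖ₑ := by
          rw [hG]
          exact (lintegral_tsum fun n => ((hmeas n).enorm.mul hSm).aemeasurable).symm
      _ ≤ ∫⁻ p, ‖𝒟.slotIntegrand u v w (θ, p)‖ₑ := by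
          refine lintegral_mono fun p => ?_
          rw [ENNReal.tsum_mul_right]
          exact mul_le_of_le_one_left zero_le (hbound p)
      _ = ∫⁻ p, ‖eulerIntegrand (𝒟.slot 0 θ u) (𝒟.slot 1 θ v) (𝒟.slot 2 θ w) p‖ₑ := by
          refine lintegral_congr_ae ?_
          filter_upwards [𝒟.eulerIntegrand_slot_ae_eq u v w θ] with p hp
          rw [hp]
      _ ≤ K * (symbolSeminorm 0 (𝒟.m 0 θ) * symbolSeminorm 0 (𝒟.m 1 θ) *
          symbolSeminorm 0 (𝒟.m 2 θ)) :=
          𝒟.lintegral_enorm_eulerIntegrand_slot_le (fun i θ => (hC i θ).2) u v w θ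
  calc ∑' n, ∫⁻ θ, ‖weightedForm (Wn n) (𝒟.slot 0 θ u) (𝒟.slot 1 θ v) (𝒟.slot 2 θ w)‖ₑ ∂𝒟.μ
      ≤ ∑' n, ∫⁻ θ, G n θ ∂𝒟.μ := ENNReal.tsum_le_tsum fun n => lintegral_mono fun θ => hle n θ
    _ = ∫⁻ θ, ∑' n, G n θ ∂𝒟.μ := (lintegral_tsum fun n => (hGm n).aemeasurable).symm
    _ ≤ ∫⁻ θ, K * (symbolSeminorm 0 (𝒟.m 0 θ) * symbolSeminorm 0 (𝒟.m 1 θ) *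
          symbolSeminorm 0 (𝒟.m 2 θ)) ∂𝒟.μ := lintegral_mono fun θ => hsum θ
    _ = K * ∫⁻ θ, symbolSeminorm 0 (𝒟.m 0 θ) * symbolSeminorm 0 (𝒟.m 1 θ) *
          symbolSeminorm 0 (𝒟.m 2 θ) ∂𝒟.μ := lintegral_const_mul' K _ hKtop.ne
    _ < ∞ := ENNReal.mul_lt_top hKtop (𝒟.moment 0 0 0)

/-- The Euler integrand of the slots is integrable on `ℝ⁶` for `u, v ∈ H¹⁰` (absolute convergence
of (1.3) at the slots). [cite: Tao2016AveragedNS, §1.1 p. 7] -/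
theorem integrable_eulerIntegrand_slot {u v : L2C} (w : L2C) (θ : 𝒟.Ω)
    (hu : FunctionSpaces.eFourierSobolevNorm 10 u < ∞) (hv : FunctionSpaces.eFourierSobolevNorm 10 v < ∞) :
    Integrable (eulerIntegrand (𝒟.slot 0 θ u) (𝒟.slot 1 θ v) (𝒟.slot 2 θ w)) :=
  integrable_Λ_fourierFn _ (𝒟.eFourierSobolevNorm_slot_lt_top 0 θ hu)
    (𝒟.eFourierSobolevNorm_slot_lt_top 1 θ hv)

end ComplexAveragingDatum

end Literature.Analysis.FluidPDE.Tao2016
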